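import Summits.BirchSwinnertonDyer.Rank1Residual.GaloisImage.CanonicalKolyvaginDatumAdmissiblePrimePow
import Summits.BirchSwinnertonDyer.Rank1Residual.GaloisImage.SakamotoN11Instance
import Summits.BirchSwinnertonDyer.Rank1Residual.GaloisImage.KolyvaginDeepSubclassTransport
import HarnessLib

/-!
# Admissibility of the canonical Kolyvagin datum, DEEP twin: data whose primes form a SUB-class of
# Sakamoto's `τ`-class (e.g. the deep class cut out at `3^{k′+1}` through `E[3^{k′+1}]`, for a datum
# on `E[3^{k+1}]`) — [MR04] Lemma 1.2.3 prime by prime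
# (cell `b2b-bsdres`, team n1011; lead deal R5-57 "the deep-datum `IsAdmissible` twin of F9
# p276215"; seat p11 gen 4; row T-HCC-adm, file 10)

HONEST FRAMING (cell `b2b-bsdres`, run/shared/lean/b2b/bsd-rank1-residual/, verbatim in every
file): the goal of the cell is to DELETE the COMBINATION-SHAPED residual classes of the
Birch–Swinnerton-Dyer formula for ALL analytic-rank `≤ 1` elliptic curves over `ℚ` — "full BSD
formula for every rank `≤ 1` curve in class `C`" assembled STRICTLY from published theorems — so
that the rank-`≤ 1` remainder becomes exactly the CONSTRUCTION-SHAPED classes, which are TYPED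
(missing-input `Prop`s), NOT attempted. This is not "finishing BSD". Team n1011 (N10 / N11, the
additive block X4 ∧ `p = 3`): research route on the CONSTRUCTION-SHAPED class X4; no claim beyond the
stated classes; nothing is booked. TOOL theorems of Galois cohomology; no definition, no named fact,
no `sorry`; unconditional.

## What

Files 4 and 9 (`CanonicalKolyvaginDatumAdmissible[PrimePow]`, p272806 / p276215) prove
`D.IsAdmissible` for data whose primes are PINNED to the module's own `τ`-class
(`D.primes = frobeniusClassPrimes ρ S τ N`).  Their proof is prime by prime, so it applies verbatim to
data whose primes form any SUBSET of that class — the shape of the DEEP data of ROUTE-1 §27 (row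
T-S24D, n1011-p15: `D.primes = frobeniusClassPrimes ρ′ S τ N′` for a deeper module `ρ′` with
`ker ρ′ ≤ ker ρ` and `N ∣ N′`, a subset of the `τ`-class of `ρ` by cc-typer-1's
`S24Deep.frobeniusClassPrimes_mono`, p269262):

* `FSComp.isAdmissible_of_hasCanonicalComparison_of_subset` (prime modulus `p`) and
  `FSComp.isAdmissible_of_hasCanonicalComparison_of_subset_primePow` (modulus `p^n`) —
  `D.primes ⊆ frobeniusClassPrimes ρ S τ N`, `D.HasCanonicalComparison N η` ⟹ `D.IsAdmissible`;
* `FSComp.isAdmissible_of_hasCanonicalComparison_of_ker_le_primePow` — the same with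
  `D.primes = frobeniusClassPrimes ρ′ S τ N′`, `ker ρ′ ≤ ker ρ`, `N ∣ N′` (T-S24D's currency);
* `isAdmissible_of_hasCanonicalComparison_torsion_deep` — the N11 spelling: a datum on `E[3^{k+1}]`
  (`geomTorsion W (3^k·3)`, n1011-p13's instances) with primes the deep class through `E[3^{k′+1}]`
  at `3^{k′+1}`, `k ≤ k′`, `τ ∈ Gal(ℚ̄/ℚ(μ_{3^{k′+1}}))`, `E[3^{k+1}]/(τ−1) ≅ ℤ/3^{k+1}`.

Anti-collision (lead R5-57): the deep datum constructor, the local shape on deep data and the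
S24-DEEP instances are row T-S24D (n1011-p15) and are NOT in this file; nothing of that row is
restated or imported here.

References: B. Mazur, K. Rubin, Mem. AMS 799 (2004), Lemma 1.2.3 (pp. 10–11), §3.5 (H.5) (p. 27),
Prop. A.2 (pp. 79–80); K. Rubin, PCMI 18 (2011) Ex. 1.9.7; R. Sakamoto, JTNB 36 (2024) §2, §4.
-/

noncomputable section

open scoped Classical NumberField ContRepresentation
open Field NumberField IsDedekindDomain Polynomial Module
open WeierstrassCurve Literature.NumberTheory.EllipticCurves Literature.NumberTheory.GaloisRepresentations
  Literature.NumberTheory.GaloisRepresentations.DiscreteGaloisModule Literature.NumberTheory.GaloisCohomology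

namespace Summit.BirchSwinnertonDyer.Rank1Residual.GaloisImage

namespace FSComp

/-! ### §1 Prime modulus, primes in a subset of the `τ`-class -/

section SubsetPrime

variable {M : Type} [AddCommGroup M] [TopologicalSpace M] [DiscreteTopology M]
variable (ρ : DiscreteGaloisModule ℚ M) (p : ℕ) [Fact p.Prime] [Module (ZMod p) M]
  [Module.Free (ZMod p) M] [Module.Finite (ZMod p) M]

/-- **Admissibility, prime modulus, primes in a SUBSET of the `τ`-class** (the proof of
`isAdmissible_of_hasCanonicalComparison_frobeniusClassPrimes`, p272806, is prime by prime).
[cite: MazurRubin2004, Lemma 1.2.3 (p. 10–11)] [cite: Rubin2011, Exercise 1.9.7 (p. 15)] -/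
theorem isAdmissible_of_hasCanonicalComparison_of_subset
    (S : Set (HeightOneSpectrum (𝓞 ℚ))) {τ : absoluteGaloisGroup ℚ}
    (hτq : Nonempty (cokerSubOne ρ τ ≃+ ZMod p)) (hτμ : τ ∈ rootsOfUnityFixer ℚ p)
    {D : KolyvaginDatum ρ} (hP : D.primes ⊆ frobeniusClassPrimes ρ S τ p)
    {η : (q : HeightOneSpectrum (𝓞 ℚ)) → (ZMod (Ideal.absNorm q.asIdeal))ˣ}
    (hD : D.HasCanonicalComparison p η) : D.IsAdmissible := by
  classical
  have hp : p.Prime := Fact.out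
  haveI : NeZero p := ⟨hp.ne_zero⟩
  haveI : Finite M := Module.finite_of_finite (ZMod p)
  intro q hq
  have hq' : q ∈ frobeniusClassPrimes ρ S τ p := hP hq
  haveI : Fact (Ideal.absNorm q.asIdeal).Prime := ⟨prime_absNorm_rat q⟩
  haveI : CharZero (q.adicCompletion ℚ) :=
    charZero_of_injective_algebraMap (algebraMap ℚ (q.adicCompletion ℚ)).injective
  haveI : NeZero ((Ideal.absNorm q.asIdeal : ℕ) : q.adicCompletion ℚ) :=
    ⟨Nat.cast_ne_zero.2 (Fact.out : (Ideal.absNorm q.asIdeal).Prime).ne_zero⟩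
  have hI : ∀ t ∈ absInertia (q.adicCompletion ℚ), GaloisRep.toLocal q ρ t = 1 := fun t ht =>
    (GaloisRep.isUnramifiedAt_iff_toLocal_holds q ρ).1 hq'.2.2.1 t ht
  obtain ⟨φ, hφ⟩ := exists_isAbsArithFrob_holds (F := q.adicCompletion ℚ)
  obtain ⟨g, hg⟩ := exists_toLocal_eq_conj ρ p S τ hq' hφ
  have hcok : Nonempty (cokerSubOne (GaloisRep.toLocal q ρ) φ ≃+ ZMod p) :=
    nonempty_cokerSubOne_equiv_of_eq_conj ρ (GaloisRep.toLocal q ρ) hg hτq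
  obtain ⟨t, ht, hχt⟩ := modPCyclotomicCharacter_surjOn_absInertia_rat_holds q (η q)
  have hη : localNormCyclotomicCharacter q t = η q := by
    rw [localNormCyclotomicCharacter_eq_modPCyclotomicCharacterZMod]; exact hχt
  have hinj := injective_fs_of_isFiniteSingularComparisonWith (GaloisRep.toLocal q ρ) p hI hφ hcok
    (hD.at hq hφ ht hη)
  refine ⟨hinj, ?_⟩
  have hMN : ∀ m : M, p • m = 0 := fun m => by
    rw [← Nat.cast_smul_eq_nsmul (ZMod p), ZMod.natCast_self, zero_smul]
  have hM : ∀ m : M, (Ideal.absNorm q.asIdeal - 1) • m = 0 :=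
    absNorm_sub_one_smul_eq_zero_of_mem_frobeniusClassPrimes ρ hq' hτμ hMN
  have hU : Nat.card (unramifiedSubgroup (GaloisRep.toLocal q ρ) 1) = p :=
    natCard_unramifiedSubgroup_toLocal_of_mem_frobeniusClassPrimes ρ hq' hτq
  have hT : Nat.card (cyclotomicTransverse ρ (Sum.inr q)) = p :=
    natCard_cyclotomicTransverse_rat_of_mem_frobeniusClassPrimes' ρ hq' hτq hM
  have hUT := unramifiedSubgroup_sup_cyclotomicTransverse_eq_top_of_mem_frobeniusClassPrimes ρ hq'
    hM (modPCyclotomicCharacter_surjOn_absInertia_rat_holds q)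
  set U := unramifiedSubgroup (GaloisRep.toLocal q ρ) 1 with hUdef
  haveI : Finite (cyclotomicTransverse ρ (Sum.inr q)) :=
    Nat.finite_of_card_ne_zero (by rw [hT]; exact hp.ne_zero)
  haveI : Finite U := Nat.finite_of_card_ne_zero (by rw [hU]; exact hp.ne_zero)
  let π : cyclotomicTransverse ρ (Sum.inr q) → SingularQuotient (GaloisRep.toLocal q ρ) :=
    fun y => singularMap (GaloisRep.toLocal q ρ) y.1
  have hπ : Function.Surjective π := by
    intro c
    obtain ⟨x, rfl⟩ := QuotientAddGroup.mk_surjective c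
    have hx : x ∈ U ⊔ cyclotomicTransverse ρ (Sum.inr q) := by rw [hUT]; exact AddSubgroup.mem_top x
    obtain ⟨u, hu, y, hy, rfl⟩ := AddSubgroup.mem_sup.mp hx
    refine ⟨⟨y, hy⟩, ?_⟩
    show singularMap (GaloisRep.toLocal q ρ) y = QuotientAddGroup.mk (u + y)
    rw [QuotientAddGroup.mk_add, (QuotientAddGroup.eq_zero_iff u).mpr hu, zero_add]
    rfl
  haveI : Finite (SingularQuotient (GaloisRep.toLocal q ρ)) := Finite.of_surjective π hπ
  have hle : Nat.card (SingularQuotient (GaloisRep.toLocal q ρ)) ≤ p := by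
    rw [← hT]; exact Nat.card_le_card_of_surjective π hπ
  have hge : p ≤ Nat.card (SingularQuotient (GaloisRep.toLocal q ρ)) := by
    rw [← hU]; exact Nat.card_le_card_of_injective _ hinj
  have hcard : Nat.card U = Nat.card (SingularQuotient (GaloisRep.toLocal q ρ)) := by
    rw [hU]; exact le_antisymm hge hle
  exact ((Nat.bijective_iff_injective_and_card _).mpr ⟨hinj, hcard⟩).2

end SubsetPrime

/-! ### §2 Prime-power modulus, primes in a subset of the `τ`-class / in a deeper module's class -/

section SubsetPrimePow

variable {M : Type} [AddCommGroup M] [TopologicalSpace M] [DiscreteTopology M]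
variable (ρ : DiscreteGaloisModule ℚ M) (p n : ℕ) [Fact p.Prime] [NeZero n]
  [Module (ZMod (p ^ n)) M] [Module.Free (ZMod (p ^ n)) M] [Module.Finite (ZMod (p ^ n)) M]

/-- **Admissibility, prime-power modulus, primes in a SUBSET of the `τ`-class** (the proof of
`isAdmissible_of_hasCanonicalComparison_frobeniusClassPrimes_primePow`, p276215, is prime by prime).
[cite: MazurRubin2004, Lemma 1.2.3 (p. 10–11)] [cite: Rubin2011, Exercise 1.9.7 (p. 15)] -/
theorem isAdmissible_of_hasCanonicalComparison_of_subset_primePow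
    (S : Set (HeightOneSpectrum (𝓞 ℚ))) {τ : absoluteGaloisGroup ℚ}
    (hτq : Nonempty (cokerSubOne ρ τ ≃+ ZMod (p ^ n))) (hτμ : τ ∈ rootsOfUnityFixer ℚ (p ^ n))
    {D : KolyvaginDatum ρ} (hP : D.primes ⊆ frobeniusClassPrimes ρ S τ (p ^ n))
    {η : (q : HeightOneSpectrum (𝓞 ℚ)) → (ZMod (Ideal.absNorm q.asIdeal))ˣ}
    (hD : D.HasCanonicalComparison (p ^ n) η) : D.IsAdmissible := by
  classical
  have hp : p.Prime := Fact.out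
  have hpn0 : p ^ n ≠ 0 := pow_ne_zero _ hp.ne_zero
  haveI : NeZero (p ^ n) := ⟨hpn0⟩
  haveI : Finite M := Module.finite_of_finite (ZMod (p ^ n))
  intro q hq
  have hq' : q ∈ frobeniusClassPrimes ρ S τ (p ^ n) := hP hq
  haveI : Fact (Ideal.absNorm q.asIdeal).Prime := ⟨prime_absNorm_rat q⟩
  haveI : CharZero (q.adicCompletion ℚ) :=
    charZero_of_injective_algebraMap (algebraMap ℚ (q.adicCompletion ℚ)).injective
  haveI : NeZero ((Ideal.absNorm q.asIdeal : ℕ) : q.adicCompletion ℚ) :=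
    ⟨Nat.cast_ne_zero.2 (Fact.out : (Ideal.absNorm q.asIdeal).Prime).ne_zero⟩
  have hI : ∀ t ∈ absInertia (q.adicCompletion ℚ), GaloisRep.toLocal q ρ t = 1 := fun t ht =>
    (GaloisRep.isUnramifiedAt_iff_toLocal_holds q ρ).1 hq'.2.2.1 t ht
  obtain ⟨φ, hφ⟩ := exists_isAbsArithFrob_holds (F := q.adicCompletion ℚ)
  obtain ⟨g, hg⟩ := exists_toLocal_eq_conj ρ (p ^ n) S τ hq' hφ
  have hcok : Nonempty (cokerSubOne (GaloisRep.toLocal q ρ) φ ≃+ ZMod (p ^ n)) :=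
    nonempty_cokerSubOne_equiv_of_eq_conj ρ (GaloisRep.toLocal q ρ) hg hτq
  obtain ⟨t, ht, hχt⟩ := modPCyclotomicCharacter_surjOn_absInertia_rat_holds q (η q)
  have hη : localNormCyclotomicCharacter q t = η q := by
    rw [localNormCyclotomicCharacter_eq_modPCyclotomicCharacterZMod]; exact hχt
  have hinj := injective_fs_of_isFiniteSingularComparisonWith_primePow (GaloisRep.toLocal q ρ) p n
    hI hφ hcok (hD.at hq hφ ht hη)
  refine ⟨hinj, ?_⟩
  have hMN : ∀ m : M, (p ^ n) • m = 0 := fun m => by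
    rw [← Nat.cast_smul_eq_nsmul (ZMod (p ^ n)), ZMod.natCast_self, zero_smul]
  have hM : ∀ m : M, (Ideal.absNorm q.asIdeal - 1) • m = 0 :=
    absNorm_sub_one_smul_eq_zero_of_mem_frobeniusClassPrimes ρ hq' hτμ hMN
  have hU : Nat.card (unramifiedSubgroup (GaloisRep.toLocal q ρ) 1) = p ^ n :=
    natCard_unramifiedSubgroup_toLocal_of_mem_frobeniusClassPrimes ρ hq' hτq
  have hT : Nat.card (cyclotomicTransverse ρ (Sum.inr q)) = p ^ n :=
    natCard_cyclotomicTransverse_rat_of_mem_frobeniusClassPrimes' ρ hq' hτq hM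
  have hUT := unramifiedSubgroup_sup_cyclotomicTransverse_eq_top_of_mem_frobeniusClassPrimes ρ hq'
    hM (modPCyclotomicCharacter_surjOn_absInertia_rat_holds q)
  set U := unramifiedSubgroup (GaloisRep.toLocal q ρ) 1 with hUdef
  haveI : Finite (cyclotomicTransverse ρ (Sum.inr q)) :=
    Nat.finite_of_card_ne_zero (by rw [hT]; exact hpn0)
  haveI : Finite U := Nat.finite_of_card_ne_zero (by rw [hU]; exact hpn0)
  let π : cyclotomicTransverse ρ (Sum.inr q) → SingularQuotient (GaloisRep.toLocal q ρ) :=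
    fun y => singularMap (GaloisRep.toLocal q ρ) y.1
  have hπ : Function.Surjective π := by
    intro c
    obtain ⟨x, rfl⟩ := QuotientAddGroup.mk_surjective c
    have hx : x ∈ U ⊔ cyclotomicTransverse ρ (Sum.inr q) := by rw [hUT]; exact AddSubgroup.mem_top x
    obtain ⟨u, hu, y, hy, rfl⟩ := AddSubgroup.mem_sup.mp hx
    refine ⟨⟨y, hy⟩, ?_⟩
    show singularMap (GaloisRep.toLocal q ρ) y = QuotientAddGroup.mk (u + y)
    rw [QuotientAddGroup.mk_add, (QuotientAddGroup.eq_zero_iff u).mpr hu, zero_add]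
    rfl
  haveI : Finite (SingularQuotient (GaloisRep.toLocal q ρ)) := Finite.of_surjective π hπ
  have hle : Nat.card (SingularQuotient (GaloisRep.toLocal q ρ)) ≤ p ^ n := by
    rw [← hT]; exact Nat.card_le_card_of_surjective π hπ
  have hge : p ^ n ≤ Nat.card (SingularQuotient (GaloisRep.toLocal q ρ)) := by
    rw [← hU]; exact Nat.card_le_card_of_injective _ hinj
  have hcard : Nat.card U = Nat.card (SingularQuotient (GaloisRep.toLocal q ρ)) := by
    rw [hU]; exact le_antisymm hge hle
  exact ((Nat.bijective_iff_injective_and_card _).mpr ⟨hinj, hcard⟩).2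

/-- **Admissibility for a datum whose primes are the `τ`-class of a DEEPER module** (row T-S24D's
currency): `D.primes = frobeniusClassPrimes ρ′ S τ N′` with `ker ρ′ ≤ ker ρ` and `p^n ∣ N′` — a
subset of the `τ`-class of `ρ` at `p^n` by cc-typer-1's `S24Deep.frobeniusClassPrimes_mono`.
[cite: MazurRubin2004, Lemma 1.2.3 (p. 10–11) and §3.5 (H.5) (p. 27)] -/
theorem isAdmissible_of_hasCanonicalComparison_of_ker_le_primePow
    {M' : Type} [AddCommGroup M'] [TopologicalSpace M'] [DiscreteTopology M']
    (ρ' : DiscreteGaloisModule ℚ M') (hker : ∀ u : absoluteGaloisGroup ℚ, ρ' u = 1 → ρ u = 1)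
    (S : Set (HeightOneSpectrum (𝓞 ℚ))) {τ : absoluteGaloisGroup ℚ} {N' : ℕ} (hN : p ^ n ∣ N')
    (hτq : Nonempty (cokerSubOne ρ τ ≃+ ZMod (p ^ n))) (hτμ : τ ∈ rootsOfUnityFixer ℚ N')
    {D : KolyvaginDatum ρ} (hP : D.primes = frobeniusClassPrimes ρ' S τ N')
    {η : (q : HeightOneSpectrum (𝓞 ℚ)) → (ZMod (Ideal.absNorm q.asIdeal))ˣ}
    (hD : D.HasCanonicalComparison (p ^ n) η) : D.IsAdmissible :=
  isAdmissible_of_hasCanonicalComparison_of_subset_primePow ρ p n S hτq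
    (rootsOfUnityFixer_le_of_dvd ℚ hN hτμ)
    (hP ▸ S24Deep.frobeniusClassPrimes_mono ρ ρ' hker S τ hN) hD

end SubsetPrimePow

end FSComp

/-! ### §3 The N11 spelling: a datum on `E[3^{k+1}]` with primes the deep class at `3^{k′+1}` -/

section TorsionDeep

variable (W : WeierstrassCurve ℚ) [W.IsElliptic]

/-- **The canonical DEEP datum on `E[3^{k+1}]` is admissible**: for `k ≤ k′`,
`τ ∈ Gal(ℚ̄/ℚ(μ_{3^{k′+1}}))` with `E[3^{k+1}]/(τ−1) ≅ ℤ/3^{k+1}`, and a Kolyvagin datum `D` on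
`E[3^{k+1}]` (n1011-p13's `ℤ/3^{k+1}`-structure instances) with
`D.primes = frobeniusClassPrimes ρ_{E,3^{k′+1}} S τ 3^{k′+1}` (the deep sub-class of ROUTE-1 §27 /
row T-S24D) and THE canonical comparison maps: `D.IsAdmissible`.
[cite: MazurRubin2004, Lemma 1.2.3 (p. 10–11) and Prop. A.2 (pp. 79–80)] [cite: Rubin2011, Exercise 1.9.7 (p. 15)] -/
theorem isAdmissible_of_hasCanonicalComparison_torsion_deep (k k' : ℕ) (hk : k ≤ k')
    (S : Set (HeightOneSpectrum (𝓞 ℚ))) {τ : absoluteGaloisGroup ℚ}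
    (hτμ : τ ∈ rootsOfUnityFixer ℚ (3 ^ (k' + 1)))
    (hτq : Nonempty (cokerSubOne (W.torsionGaloisModule (((3 : ℕ) : ℤ) ^ k * ((3 : ℕ) : ℤ))) τ ≃+
      ZMod (3 ^ (k + 1))))
    {D : KolyvaginDatum (W.torsionGaloisModule (((3 : ℕ) : ℤ) ^ k * ((3 : ℕ) : ℤ)))}
    (hP : D.primes = frobeniusClassPrimes (W.torsionGaloisModule (((3 : ℕ) : ℤ) ^ k' * ((3 : ℕ) : ℤ)))
      S τ (3 ^ (k' + 1)))
    {η : (q : HeightOneSpectrum (𝓞 ℚ)) → (ZMod (Ideal.absNorm q.asIdeal))ˣ}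
    (hD : D.HasCanonicalComparison (3 ^ (k + 1)) η) : D.IsAdmissible :=
  haveI : Fact (Nat.Prime 3) := ⟨Nat.prime_three⟩
  FSComp.isAdmissible_of_hasCanonicalComparison_of_ker_le_primePow
    (W.torsionGaloisModule (((3 : ℕ) : ℤ) ^ k * ((3 : ℕ) : ℤ))) 3 (k + 1)
    (W.torsionGaloisModule (((3 : ℕ) : ℤ) ^ k' * ((3 : ℕ) : ℤ)))
    (fun u hu => S24Deep.torsionGaloisModule_pow_mul_eq_one_of_le W _ hk u hu) S
    (pow_dvd_pow 3 (by omega)) hτq hτμ hP hD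

end TorsionDeep

end Summit.BirchSwinnertonDyer.Rank1Residual.GaloisImage

end
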